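import Summits.QuantumFields.BalabanUV.T4Continuum.Spine.NE1p.DressedJointAnalyticWitness

/-!
# T⁴ programme, spine estimate NE1′ (node O3b/H2) — WITNESS W54 «THE JOINT FACE FIRES WITH LIVE OPERATOR LETTERS», PART 2:
# S42 §4 `analytic_and_bounded_locE_opSource_of_coresAt_pencil_mass` APPLIED ONCE BY NAME on Part 1's live-letter core family at
# W33's periodic-carrier sockets, (B3) MET at the o-UNIFORM letters (closed form at `X₀`); GENUINE: the dressed OUTPUT is NOT
# constant in the operator datum

Cell `pub-balaban`, sub-cell `t4`, BINDER-OWNERS row NE1′; NE1′ formalisation crew, unit `b2b-balaban-t4-ne1p-formalise-leaf-03`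
(LEAF PROVER 03, generation 13); crew row W54 ∕ DAG N29zzz, PART 2 of (D1) two parts (INTENT l.20259, BOOKED typer R-T129 (i) l.20308;
X-read X173).  ADDITIVE — imports Part 1 `Spine/NE1p/DressedJointAnalyticWitness` ONLY (→ S42, W51, W35, W33, W24); toy DATA `actJ`
(`def`, marked) and theorems; nothing upstream is restated — used BY NAME.

CONTENT.  §7 (with Part 1 §6's sockets: the Cauchy weight `cJ r := A·e^{−2r}∕(4√π)` (`A = (e·K₀(64,8)·9·64)⁻¹` W24's located constant; `4√π = N₀·(π∕(mq∕2))^{1∕2}`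
at the live letters' bounds `(N₀, mq) = (2, ½)`, `letterGauss_J`) and W51's table radius `hH_pencil` (`μ₁ ≤ 2`) BY NAME): **(B3) `hM3_J`** in S42 §4's literal
letter-budget shape (`= A·e^{−2r}·e^{r·μ₁‖liveTable‖} ≤ A` at `X₀`, vacuous elsewhere), the activity `actJ k (o, s) Z := Σ_{i ∈ termsW Z}
termAt o (0 + s • liveTable)` (`hact`∕`hscale` by `rfl`), and **S42 §4 FIRES** (`jointSourceEnd_fires`: `(o, s) ↦ E[actJ (o, s)](X₀)`
complex differentiable on `{‖o‖ < 1} ×ˢ {‖s‖ < μ₁}` AND bounded by the (2.41) envelope — conclusion LITERAL; closed form `≤ K₀(64,8)` by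
`torus_consts` ∕ `K₀_four`), the LIVE letter blocks `hN_J`∕`hq_J` of Part 1 feeding S42's operator-holomorphy clauses; §8 GENUINE ON THE
TORUS DATUM: `actJ k (o, 0) X₀ = termAt o 0` (`actJ_X₀_source_zero`), both `‖actJ k (0,0) X₀‖ = A·e^{−2r}∕4 < 1` and `‖actJ k (½,0) X₀‖ ≤
(5∕16)·A·e^{−2r} < 1` (`A ≤ 1`, W24 `dressedConst_le_one`), so W24's `exp_locE_cube` (`exp E_w({0}) = 1 + w X₀`) BY NAME turns equal
outputs into equal terms — `outputJ_op_live`: `E[actJ (0, 0)](X₀) ≠ E[actJ (½, 0)](X₀)` by Part 1's `termAt_op_live`: S42 §4's joint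
holomorphy is charged by a quantity that MOVES in the operator direction (the source direction: W35∕W51's pattern, not re-proved).

HONEST FRAMING.  A DECIDED TOY of NE5's witness KIND, not Bałaban's (2.14) data; `9`, `64`, `64·log 162`, `K₀ 64 8` are pv22's PROVED
constants BY NAME, `A` W24's located constant; (B1a) kernel as in S42 (relocated onto the Gaussian LETTER hypotheses — identification
with Bałaban's (2.14) = the substrate's DISPLAYED reading, NOT claimed); (B1b)'s residue, (B3) = `hM3` (G-ne9p2-5 UNPRINTED, shared
with NE9), clause SHAPES, `hH` DISPLAYED in the faces and merely MET on the toy; no numeral of print; 0 binders instantiated on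
Bałaban's densities; no new inequality; no wall item of NE1′ or NE5 moves; wall v1.7 (T4-DAG v46) does NOT move; R-t4r2-Q2 NOT met.
NE1′ ⇐ the named binders — NOT proved, NOT printed; spine PROVED 0∕9; count 9 unchanged.  Rung (B)+1 on ONE finite four-torus — NOT
infinite volume, NOT a mass gap, NOT OS on ℝ⁴, NOT Clay.  HONEST DEPENDENCY: continuum YM on T⁴ ⇐ BetaPertH ∧ nine spine estimates
(0/9 proved); BetaPertH ⇐ (D1) ∧ (D4) ∧ CAP+tail; G-an2-4 gates asym, D1 and NE2/3/4.
-/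

noncomputable section

namespace Summit.QuantumFields.BalabanUV.T4Continuum.NE1p.DressedJointAnalyticWitnessEnd

open Set Metric MeasureTheory Complex
open scoped BigOperators
open Literature.MathematicalPhysics.QuantumFieldTheory.Balaban1983to89
open Literature.MathematicalPhysics.QuantumFieldTheory.Balaban1983to89.B12TreeDecay (K₀ K₀_pos)
open Literature.MathematicalPhysics.QuantumFieldTheory.Balaban1983to89.B13Resummation (locE)
open Literature.MathematicalPhysics.QuantumFieldTheory.Balaban1983to89.TreeLengthTorus (TDom tsys torusTreeLen torusTreeLen_singleton)
open Literature.MathematicalPhysics.QuantumFieldTheory.Balaban1983to89.TreeLengthTorusGeometry (tgeometry TTouch)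
open Summit.QuantumFields.BalabanUV.T4Continuum.B13HistMeasurable (B13HistM)
open Summit.QuantumFields.BalabanUV.T4Continuum.B13HistWitness (toyFrame)
open Summit.QuantumFields.BalabanUV.T4Continuum.NE1p.DressedSmallFieldTorusWitness (X₀ X₀_val eq_X₀_iff hrate_torus
  dressedConst_le_one exp_locE_cube)
open Summit.QuantumFields.BalabanUV.T4Continuum.NE1p.DressedSmallFieldGeometry (torus_consts)
open Summit.QuantumFields.BalabanUV.T4Continuum.NE1p.DressedSmallFieldGeometryFaces (K₀_four)
open Summit.QuantumFields.BalabanUV.T4Continuum.NE1p.DressedSmallFieldCoresWitness (E1 liveTable norm_liveTable_le ctr0 hroom0 Acst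
  Acst_pos termsW termsW_X₀)
open Summit.QuantumFields.BalabanUV.T4Continuum.NE1p.DressedSmallFieldCoresMassWitness (hsmall_mu)
open Summit.QuantumFields.BalabanUV.T4Continuum.NE1p.DressedJointAnalyticOnCores (analytic_and_bounded_locE_opSource_of_coresAt_pencil_mass)
open Summit.QuantumFields.BalabanUV.T4Continuum.NE1p.DressedJointAnalyticWitness (coreJ coreFamJ N₁_coreJ hN_J hq_J termAt_zero_zero
  termAt_half_zero termAt_op_live cJ cJ_pos letterGauss_J)
open Summit.QuantumFields.BalabanUV.T4Continuum.NE1p.DressedSourceAnalyticWitness (hH_pencil)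

variable (r : ℝ) (hr : 0 ≤ r)

/-! ## §7 S42 §4 FIRES ON THE PERIODIC CARRIER: the joint (operator datum, source) END with (B3) MET at the o-UNIFORM letters -/

section Torus
variable (N : ℕ) [NeZero N]

/-- **(B3) `hM3` MET AT THE o-UNIFORM LETTERS** (`N₀ = 2`, `mq = ½`, `bq = 0`; source radius `μ₁ ≤ 2`) [decided toy]: at `X₀` the
letter mass times the read-out growth is `1·(cJ·2·e⁰)·2√π·e^{r·μ₁‖liveTable‖} = A·e^{−2r}·e^{r·μ₁‖liveTable‖} ≤ A` (decay factor `1`: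
`d(X₀) = 0`); vacuous elsewhere. [folklore] -/
theorem hM3_J {μ₁ : ℝ} (hμ₁ : μ₁ ≤ 2) (k : ℕ) (R : ℝ) :
    ∀ Z : (tsys 4 N).Dom, (tgeometry 4 N).cubes Z ⊆ (tgeometry 4 N).cubes (X₀ N) →
      ∑ i ∈ termsW N Z, (coreFamJ (cJ r) r hr k i k).lam.real univ *
          ((coreFamJ (cJ r) r hr k i k).wB * (2 : ℝ) * Real.exp (0 : ℝ)) *
          (Real.pi / ((1 / 2 : ℝ) / 2)) ^ (Module.finrank ℝ E1 / 2 : ℝ) *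
        Real.exp ((coreFamJ (cJ r) r hr k i k).N₁ * (‖(0 : B13HistM toyFrame)‖ + μ₁ * ‖liveTable‖)) ≤
      Acst * Real.exp (-(R * (tsys 4 N).dj Z)) := by
  intro Z hZ
  have hZX : Z = X₀ N := (eq_X₀_iff N Z).1 ((Finset.Nonempty.subset_singleton_iff Z.2.1).1 hZ)
  subst hZX
  rw [termsW_X₀, Finset.sum_singleton]
  unfold coreFamJ
  rw [letterGauss_J, N₁_coreJ, norm_zero, zero_add, Real.exp_zero, mul_one]
  have hd : (tsys 4 N).dj (X₀ N) = 0 := by show torusTreeLen (X₀ N).1 = 0; rw [X₀_val]; exact torusTreeLen_singleton 0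
  rw [hd, mul_zero, neg_zero, Real.exp_zero, mul_one]
  show (Measure.dirac ()).real univ * (|cJ r| * 2) * (2 * Real.sqrt Real.pi) * Real.exp (r * (μ₁ * ‖liveTable‖)) ≤ Acst
  rw [probReal_univ, one_mul, abs_of_pos (cJ_pos r)]
  have hπ : 0 < Real.sqrt Real.pi := Real.sqrt_pos.2 Real.pi_pos
  have hn : μ₁ * ‖liveTable‖ ≤ 2 := by nlinarith [norm_nonneg liveTable, norm_liveTable_le]
  have hw : cJ r * 2 * (2 * Real.sqrt Real.pi) = Acst * Real.exp (-(2 * r)) := by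
    unfold cJ; field_simp; ring
  rw [hw, mul_assoc, ← Real.exp_add]
  calc Acst * Real.exp (-(2 * r) + r * (μ₁ * ‖liveTable‖)) ≤ Acst * Real.exp 0 := by
        gcongr
        · exact Acst_pos.le
        · nlinarith
    _ = Acst := by rw [Real.exp_zero, mul_one]

/-- THE ACTIVITY OF RECORD, JOINTLY IN (OPERATOR DATUM, SOURCE) (toy DATA): the sum of the cores' terms at operator datum `o` along the
source pencil `s ↦ 0 + s • liveTable` — BY DEFINITION (`hact`∕`hscale` by `rfl`). [folklore] -/
def actJ (k : ℕ) (p : ℂ × ℂ) (Z : TDom 4 N) : ℂ :=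
  ∑ i ∈ termsW N Z, (coreFamJ (cJ r) r hr k i k).termAt p.1 ((0 : B13HistM toyFrame) + p.2 • liveTable)

open Classical in
/-- **S42 §4 `analytic_and_bounded_locE_opSource_of_coresAt_pencil_mass` FIRES ON THE LIVE-LETTER CORE** [decided toy]: the family
`coreFamJ` at weight `cJ`, the LIVE letter blocks `hN_J`∕`hq_J` (§3), W33's `hroom0`∕`ctr0`, W51's table radius `hH_pencil` (`μ₁ ≤ 2`),
`hscale`∕`hact` by `rfl`, W24's `hrate_torus`, W35's `hsmall_mu`, `hM3_J`.  Conclusion LITERAL: `(o, s) ↦ E[actJ (o, s)](X₀)` is complex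
differentiable on `{‖o‖ < 1} ×ˢ {‖s‖ < μ₁}` AND bounded there by the (2.41) envelope. [folklore] -/
theorem jointSourceEnd_fires {μ₁ : ℝ} (hμ₁ : μ₁ ≤ 2) (k : ℕ) :
    DifferentiableOn ℂ (fun p : ℂ × ℂ => locE (tgeometry 4 N).ι (tgeometry 4 N).cubes (actJ r hr N k p)
        ((tgeometry 4 N).cubes (X₀ N))) (ball (0 : ℂ) 1 ×ˢ ball (0 : ℂ) μ₁) ∧
      ∀ p ∈ ball (0 : ℂ) 1 ×ˢ ball (0 : ℂ) μ₁, ‖locE (tgeometry 4 N).ι (tgeometry 4 N).cubes (actJ r hr N k p)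
          ((tgeometry 4 N).cubes (X₀ N))‖ ≤
        Real.exp 1 * (tgeometry 4 N).ν * (tgeometry 4 N).c₁ * (tgeometry 4 N).K₀ ^ 2 * Acst *
          Real.exp (-(0 * (tsys 4 N).dj (X₀ N))) :=
  analytic_and_bounded_locE_opSource_of_coresAt_pencil_mass (tsys 4 N) (tgeometry 4 N) (coreFamJ (cJ r) r hr)
    (W := Set.univ) (ctr := ctr0) (ROp := fun _ => 1) (RHist := fun _ => 2) (R' := fun _ => 2)
    (mq := fun _ _ _ => 1 / 2) (bq := fun _ _ _ => 0) (N₀ := fun _ _ _ => 2)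
    hroom0 (fun _ _ _ _ _ _ _ => by norm_num) (fun k g _ U X _ i => hN_J (cJ r) r hr k g U X i)
    (fun k g _ U X _ i => hq_J (cJ r) r hr k g U X i)
    (g := fun _ => 0) (Set.mem_univ _) (U := ()) (h₀ := 0) (v := liveTable) (μ₁ := μ₁) (hH_pencil hμ₁ k)
    (emb := fun _ => k) (fun _ => rfl) (terms := termsW N) (act := actJ r hr N k) (fun _ _ _ => rfl)
    (A := Acst) (R := 2 * (tgeometry 4 N).κ₀ + 2) (r₁ := 0) (b₅ := 0) (X₀ := X₀ N)
    Acst_pos.le le_rfl (by norm_num) (hrate_torus N) (hsmall_mu N) (hM3_J r hr N hμ₁ k _)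

open Classical in
/-- … the envelope in CLOSED FORM: `‖E[actJ (o, s)](X₀)‖ ≤ K₀(64,8)` on `{‖o‖ < 1} ×ˢ {‖s‖ < μ₁}` (pv22's constants BY NAME). [folklore] -/
theorem jointSourceEnd_fires_closed {μ₁ : ℝ} (hμ₁ : μ₁ ≤ 2) (k : ℕ) {p : ℂ × ℂ}
    (hp : p ∈ ball (0 : ℂ) 1 ×ˢ ball (0 : ℂ) μ₁) :
    ‖locE (tgeometry 4 N).ι (tgeometry 4 N).cubes (actJ r hr N k p) ((tgeometry 4 N).cubes (X₀ N))‖ ≤ K₀ 64 8 := by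
  refine ((jointSourceEnd_fires r hr N hμ₁ k).2 p hp).trans (le_of_eq ?_)
  rw [(torus_consts N).1, (torus_consts N).2.2, K₀_four, zero_mul, neg_zero, Real.exp_zero, mul_one]
  unfold Acst
  have hK := K₀_pos (64 : ℝ) 8
  have he := Real.exp_pos 1
  field_simp

/-! ## §8 GENUINE ON THE TORUS DATUM: the dressed OUTPUT is NOT constant in the operator datum -/

/-- The activity at `X₀` is the one core's term along the pencil. [folklore] -/
theorem actJ_X₀ (k : ℕ) (p : ℂ × ℂ) :
    actJ r hr N k p (X₀ N) = (coreJ (cJ r) r hr).termAt p.1 ((0 : B13HistM toyFrame) + p.2 • liveTable) := by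
  unfold actJ; rw [termsW_X₀, Finset.sum_singleton]; rfl

/-- At source `0` the activity at `X₀` is the term at table `0`. [folklore] -/
theorem actJ_X₀_source_zero (k : ℕ) (o : ℂ) : actJ r hr N k (o, 0) (X₀ N) = (coreJ (cJ r) r hr).termAt o 0 := by
  rw [actJ_X₀]
  show (coreJ (cJ r) r hr).termAt o ((0 : B13HistM toyFrame) + (0 : ℂ) • liveTable) = _
  rw [zero_smul, add_zero]

/-- `cJ·√π = A·e^{−2r}∕4 < 1` — the activity at `(0, 0)` is strictly inside the unit disc (`A ≤ 1`, W24). [folklore] -/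
theorem norm_actJ_zero_lt_one (k : ℕ) : ‖actJ r hr N k (0, 0) (X₀ N)‖ < 1 := by
  rw [actJ_X₀_source_zero, termAt_zero_zero, norm_mul, Complex.norm_real, Complex.norm_real, Real.norm_eq_abs,
    Real.norm_eq_abs, abs_of_pos (cJ_pos r), abs_of_nonneg (Real.sqrt_nonneg _)]
  have hπ : 0 < Real.sqrt Real.pi := Real.sqrt_pos.2 Real.pi_pos
  have hA : Acst ≤ 1 := dressedConst_le_one
  have he : Real.exp (-(2 * r)) ≤ 1 := Real.exp_le_one_iff.2 (by linarith)
  have hApos := Acst_pos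
  have hepos := Real.exp_pos (-(2 * r))
  unfold cJ
  rw [div_mul_eq_mul_div, show Acst * Real.exp (-(2 * r)) * Real.sqrt Real.pi / (4 * Real.sqrt Real.pi) =
    Acst * Real.exp (-(2 * r)) / 4 by field_simp]
  nlinarith [mul_le_mul hA he hepos.le zero_le_one]

/-- `cJ·(5∕4)·√(8π∕9) ≤ cJ·(5∕4)·√π = (5∕16)·A·e^{−2r} < 1` — the activity at `(½, 0)` is strictly inside the unit disc. [folklore] -/
theorem norm_actJ_half_lt_one (k : ℕ) : ‖actJ r hr N k (1 / 2, 0) (X₀ N)‖ < 1 := by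
  rw [actJ_X₀_source_zero, termAt_half_zero, norm_mul, Complex.norm_real, Complex.norm_real, Real.norm_eq_abs,
    Real.norm_eq_abs, abs_of_pos (cJ_pos r), abs_of_nonneg (by positivity)]
  have hπ : 0 < Real.sqrt Real.pi := Real.sqrt_pos.2 Real.pi_pos
  have h89 : Real.sqrt (8 * Real.pi / 9) ≤ Real.sqrt Real.pi := Real.sqrt_le_sqrt (by linarith [Real.pi_pos])
  have hA : Acst ≤ 1 := dressedConst_le_one
  have he : Real.exp (-(2 * r)) ≤ 1 := Real.exp_le_one_iff.2 (by linarith)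
  have hApos := Acst_pos
  have hepos := Real.exp_pos (-(2 * r))
  calc cJ r * (5 / 4 * Real.sqrt (8 * Real.pi / 9)) ≤ cJ r * (5 / 4 * Real.sqrt Real.pi) := by
        gcongr; exact (cJ_pos r).le
    _ = 5 / 16 * (Acst * Real.exp (-(2 * r))) := by unfold cJ; field_simp; ring
    _ < 1 := by nlinarith [mul_le_mul hA he hepos.le zero_le_one]

open Classical in
/-- **GENUINE — THE DRESSED OUTPUT IS NOT CONSTANT IN THE OPERATOR DATUM** [decided toy]: at source `0` the outputs at the operator
data `o = 0` and `o = ½` (both in the operator ball `‖o‖ < 1` of `jointSourceEnd_fires`) DIFFER — W24's `exp_locE_cube`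
(`exp E_w({0}) = 1 + w X₀` for `‖w X₀‖ < 1`) BY NAME turns equal outputs into equal terms at table `0`, contradicting `termAt_op_live`:
S42 §4's joint holomorphy is charged by a quantity that MOVES in the operator direction. [folklore] -/
theorem outputJ_op_live (k : ℕ) :
    locE (tgeometry 4 N).ι (tgeometry 4 N).cubes (actJ r hr N k (0, 0)) ((tgeometry 4 N).cubes (X₀ N)) ≠
      locE (tgeometry 4 N).ι (tgeometry 4 N).cubes (actJ r hr N k (1 / 2, 0)) ((tgeometry 4 N).cubes (X₀ N)) := by
  intro h
  have h0 := exp_locE_cube N (w := actJ r hr N k (0, 0)) (norm_actJ_zero_lt_one r hr N k)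
  have h1 := exp_locE_cube N (w := actJ r hr N k (1 / 2, 0)) (norm_actJ_half_lt_one r hr N k)
  have h' : cexp (locE (TTouch (d := 4) (N := N)) (fun Z : (tsys 4 N).Dom => Z.1) (actJ r hr N k (0, 0)) {0}) =
      cexp (locE (TTouch (d := 4) (N := N)) (fun Z : (tsys 4 N).Dom => Z.1) (actJ r hr N k (1 / 2, 0)) {0}) :=
    congrArg cexp h
  rw [h0, h1, add_right_inj, actJ_X₀_source_zero, actJ_X₀_source_zero] at h'
  exact termAt_op_live (cJ r) r hr (cJ_pos r).ne' h'

end Torus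

end Summit.QuantumFields.BalabanUV.T4Continuum.NE1p.DressedJointAnalyticWitnessEnd

end
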